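import Mathlib
import Literature.Computability.AlgebraicComplexity.ArithCircuitProofs
import Literature.Computability.AlgebraicComplexity.MatMulTotalComplexityProofs
import Literature.Computability.AlgebraicComplexity.DivisionSLP

/-!
# Stub `stub_pairs` of crux `HiddenToeplitzCorners.ToeplitzLikeDetCost` (stmt-MatrixMultiplication-7491),
# line `Sketch`

Strassen's numerator/denominator simulation (R-level): over `K = Frac ℂ[X_σ]`, a computation
sequence WITH division (`DivSeq`, `Derivable` of `DivisionSLP.lean`) of length `n`, fed with the
images of polynomials jointly computed by a division-free fan-in-two program `l`
(`ArithCircuit.FanInTwoSeq`), reaching the image of a polynomial `f`, yields a nonzero polynomial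
`q` with `complexity (q * f) ≤ |l| + 4 n`.

Proof: every available element of `K` is kept as a pair (numerator, denominator) of polynomials
occurring in (or freely available to) an accumulated fan-in-two program; a linear step
`c • x + d • y` costs the four gates `p q'`, `p' q`, `c • (p q') + d • (p' q)`, `q q'`, a product
the two gates `p p'`, `q q'`, an inversion none (swap the pair). At the end the pair `(p, q)` of
`f` satisfies `p = q * f` by injectivity of `ℂ[X_σ] → K`, and `p` is a gate value (or a free
input) of a fan-in-two program of length `≤ |l| + 4 n`, realised as an honest circuit by
`FanInTwoSeq.exists_circuit`.

Target tree file: `Summits/MatrixMultiplication/MatrixMultiplication/Theorems/HiddenToeplitzCornersToeplitzLikeDetCostPairs.lean`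
(helper for the crux, landed with `--supports stmt-MatrixMultiplication-7491`). The theorem `stub_pairs`
below must keep EXACTLY this name and signature (it is registered on the crux).

## References
* V. Strassen, *Vermeidung von Divisionen*, J. reine angew. Math. 264 (1973) 184–202, §1
  (the numerator/denominator simulation).
* P. Bürgisser, M. Clausen, M. A. Shokrollahi, *Algebraic Complexity Theory*, Springer 1997, §7.1.
-/

set_option linter.dupNamespace false

namespace Summit.MatrixMultiplication.MatrixMultiplication.Theorems

open scoped BigOperators
open Literature.Computability.AlgebraicComplexity
open Literature.Computability.AlgebraicComplexity.ArithCircuit (FanInTwoSeq freeInputs)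

noncomputable section

/-! ## Auxiliary lemmas -/

/-- A polynomial occurring in (or freely available to) a semantic fan-in-two program over the free
inputs has complexity at most the length of the program: realise the program as an honest circuit
(`FanInTwoSeq.exists_circuit`) and read the value off by an operand. [folklore] -/
theorem complexity_le_length_of_fanInTwoSeq {k : Type*} [CommSemiring k] {σ : Type*}
    {l : List (MvPolynomial σ k)} (hl : FanInTwoSeq (freeInputs k σ) l) {p : MvPolynomial σ k}
    (hp : p ∈ freeInputs k σ ∪ {x | x ∈ l}) : complexity p ≤ l.length := by
  obtain ⟨P, hP2, hPv, hPs⟩ := ArithCircuit.FanInTwoSeq.exists_circuit hl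
  obtain ⟨o, ho⟩ := ArithCircuit.exists_operand_eval_eq (K := k) hp
  have hc : (⟨P.gates, o⟩ : ArithCircuit k σ).Computes p := by
    show o.eval (ArithCircuit.gateValues P.gates) = p
    rw [hPv, ho]
  calc complexity p ≤ (⟨P.gates, o⟩ : ArithCircuit k σ).size :=
        ArithCircuit.complexity_le_size (fun g hg => hP2 g hg) hc
    _ = l.length := hPs

/-- `ℂ[X_σ] → K` commutes with the scalar action of `ℂ` (scalar tower). [folklore] -/
theorem algebraMap_mvPolynomial_smul {σ : Type*} {K : Type*} [Field K]
    [Algebra (MvPolynomial σ ℂ) K] [Algebra ℂ K] [IsScalarTower ℂ (MvPolynomial σ ℂ) K]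
    (c : ℂ) (r : MvPolynomial σ ℂ) :
    algebraMap (MvPolynomial σ ℂ) K (c • r) = c • algebraMap (MvPolynomial σ ℂ) K r := by
  rw [Algebra.smul_def, map_mul, ← IsScalarTower.algebraMap_apply, Algebra.smul_def]

/-- Numerator/denominator pairs for the constants: if every element of `A` is represented by a
pair of polynomials from a set containing the free inputs, so is every element of
`A ∪ consts` (`algebraMap ℂ K c = 𝑎(C c) / 𝑎(C 1)`). [folklore] -/
theorem pairs_of_mem_union_consts {σ : Type*} {K : Type*} [Field K]
    [Algebra (MvPolynomial σ ℂ) K] [Algebra ℂ K] [IsScalarTower ℂ (MvPolynomial σ ℂ) K]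
    {A : Set K} {T : Set (MvPolynomial σ ℂ)}
    (hA : ∀ w ∈ A, ∃ p q : MvPolynomial σ ℂ, p ∈ freeInputs ℂ σ ∪ T ∧ q ∈ freeInputs ℂ σ ∪ T ∧
      algebraMap (MvPolynomial σ ℂ) K q ≠ 0 ∧
      algebraMap (MvPolynomial σ ℂ) K p = w * algebraMap (MvPolynomial σ ℂ) K q)
    {v : K} (hv : v ∈ A ∪ Set.range (algebraMap ℂ K)) :
    ∃ p q : MvPolynomial σ ℂ, p ∈ freeInputs ℂ σ ∪ T ∧ q ∈ freeInputs ℂ σ ∪ T ∧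
      algebraMap (MvPolynomial σ ℂ) K q ≠ 0 ∧
      algebraMap (MvPolynomial σ ℂ) K p = v * algebraMap (MvPolynomial σ ℂ) K q := by
  rcases hv with hv | ⟨c, rfl⟩
  · exact hA v hv
  · refine ⟨MvPolynomial.C c, MvPolynomial.C 1, Or.inl (ArithCircuit.C_mem_freeInputs c),
      Or.inl (ArithCircuit.C_mem_freeInputs 1), ?_, ?_⟩
    · rw [MvPolynomial.C_1, map_one]
      exact one_ne_zero
    · rw [MvPolynomial.C_1, map_one, mul_one,
        IsScalarTower.algebraMap_apply ℂ (MvPolynomial σ ℂ) K c, MvPolynomial.algebraMap_eq]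

/-- **One step of Strassen's simulation.** Given numerator/denominator pairs (inside an
accumulated fan-in-two program `L`) for the available set `A`, one `Ω`-step `v` from `A` is
simulated by at most four new gates: `c • x + d • y ↦ (c • (p q') + d • (p' q), q q')` via
`p q'`, `p' q`; `x * y ↦ (p p', q q')`; `x⁻¹ ↦ (q, p)`. [cite: Strassen1973, §1] -/
theorem pairs_step {σ : Type*} {K : Type*} [Field K]
    [Algebra (MvPolynomial σ ℂ) K] [Algebra ℂ K] [IsScalarTower ℂ (MvPolynomial σ ℂ) K]
    {A : Set K} {L : List (MvPolynomial σ ℂ)} {v : K} (hL : FanInTwoSeq (freeInputs ℂ σ) L)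
    (hA : ∀ w ∈ A, ∃ p q : MvPolynomial σ ℂ, p ∈ freeInputs ℂ σ ∪ {x | x ∈ L} ∧
      q ∈ freeInputs ℂ σ ∪ {x | x ∈ L} ∧ algebraMap (MvPolynomial σ ℂ) K q ≠ 0 ∧
      algebraMap (MvPolynomial σ ℂ) K p = w * algebraMap (MvPolynomial σ ℂ) K q)
    (hv : DivStep ℂ A v) :
    ∃ L₁ : List (MvPolynomial σ ℂ), L₁.length ≤ 4 ∧ FanInTwoSeq (freeInputs ℂ σ) (L ++ L₁) ∧
      ∀ w ∈ insert v A, ∃ p q : MvPolynomial σ ℂ, p ∈ freeInputs ℂ σ ∪ {x | x ∈ L ++ L₁} ∧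
        q ∈ freeInputs ℂ σ ∪ {x | x ∈ L ++ L₁} ∧ algebraMap (MvPolynomial σ ℂ) K q ≠ 0 ∧
        algebraMap (MvPolynomial σ ℂ) K p = w * algebraMap (MvPolynomial σ ℂ) K q := by
  -- Reduction: it suffices to give the new gates and a pair for `v` among them.
  have key : ∀ L₁ : List (MvPolynomial σ ℂ), L₁.length ≤ 4 →
      FanInTwoSeq ({x | x ∈ L} ∪ freeInputs ℂ σ) L₁ →
      (∃ p q : MvPolynomial σ ℂ, p ∈ freeInputs ℂ σ ∪ {x | x ∈ L ++ L₁} ∧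
        q ∈ freeInputs ℂ σ ∪ {x | x ∈ L ++ L₁} ∧ algebraMap (MvPolynomial σ ℂ) K q ≠ 0 ∧
        algebraMap (MvPolynomial σ ℂ) K p = v * algebraMap (MvPolynomial σ ℂ) K q) →
      ∃ L₁ : List (MvPolynomial σ ℂ), L₁.length ≤ 4 ∧ FanInTwoSeq (freeInputs ℂ σ) (L ++ L₁) ∧
        ∀ w ∈ insert v A, ∃ p q : MvPolynomial σ ℂ, p ∈ freeInputs ℂ σ ∪ {x | x ∈ L ++ L₁} ∧
          q ∈ freeInputs ℂ σ ∪ {x | x ∈ L ++ L₁} ∧ algebraMap (MvPolynomial σ ℂ) K q ≠ 0 ∧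
          algebraMap (MvPolynomial σ ℂ) K p = w * algebraMap (MvPolynomial σ ℂ) K q := by
    intro L₁ hlen hseq hpair
    refine ⟨L₁, hlen, hL.append hseq, ?_⟩
    intro w hw
    rcases Set.mem_insert_iff.1 hw with rfl | hw
    · exact hpair
    · obtain ⟨p, q, hp, hq, hq0, hpq⟩ := hA w hw
      refine ⟨p, q, ?_, ?_, hq0, hpq⟩
      · rcases hp with hp | hp
        · exact Or.inl hp
        · exact Or.inr (List.mem_append.2 (Or.inl hp))
      · rcases hq with hq | hq
        · exact Or.inl hq
        · exact Or.inr (List.mem_append.2 (Or.inl hq))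
  obtain ⟨x, hx, y, hy, hxy⟩ := hv
  obtain ⟨p, q, hp, hq, hq0, hpq⟩ := pairs_of_mem_union_consts hA hx
  obtain ⟨p', q', hp', hq', hq0', hpq'⟩ := pairs_of_mem_union_consts hA hy
  have hS : ∀ {r : MvPolynomial σ ℂ}, r ∈ freeInputs ℂ σ ∪ {x | x ∈ L} →
      r ∈ {x | x ∈ L} ∪ freeInputs ℂ σ := fun h => h.symm
  rcases hxy with ⟨c, d, rfl⟩ | rfl | ⟨hx0, rfl⟩
  · -- linear step: four gates
    refine key [p * q', p' * q, c • (p * q') + d • (p' * q), q * q'] (by simp) ?_ ?_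
    · exact ⟨ArithCircuit.FanInTwoStep.mul (hS hp) (hS hq'),
        ArithCircuit.FanInTwoStep.mul (Set.mem_insert_of_mem _ (hS hp'))
          (Set.mem_insert_of_mem _ (hS hq)),
        ArithCircuit.FanInTwoStep.lin (Set.mem_insert_of_mem _ (Set.mem_insert _ _))
          (Set.mem_insert _ _) c d,
        ArithCircuit.FanInTwoStep.mul
          (Set.mem_insert_of_mem _ (Set.mem_insert_of_mem _ (Set.mem_insert_of_mem _ (hS hq))))
          (Set.mem_insert_of_mem _ (Set.mem_insert_of_mem _ (Set.mem_insert_of_mem _ (hS hq')))),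
        trivial⟩
    · refine ⟨c • (p * q') + d • (p' * q), q * q', Or.inr (by simp), Or.inr (by simp), ?_, ?_⟩
      · rw [map_mul]
        exact mul_ne_zero hq0 hq0'
      · simp only [map_add, map_mul, algebraMap_mvPolynomial_smul, hpq, hpq']
        simp only [Algebra.smul_def]
        ring
  · -- product step: two gates
    refine key [p * p', q * q'] (by simp) ?_ ?_
    · exact ⟨ArithCircuit.FanInTwoStep.mul (hS hp) (hS hp'),
        ArithCircuit.FanInTwoStep.mul (Set.mem_insert_of_mem _ (hS hq))
          (Set.mem_insert_of_mem _ (hS hq')),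
        trivial⟩
    · refine ⟨p * p', q * q', Or.inr (by simp), Or.inr (by simp), ?_, ?_⟩
      · rw [map_mul]
        exact mul_ne_zero hq0 hq0'
      · rw [map_mul, map_mul, hpq, hpq']
        ring
  · -- inversion: no gate, swap the pair
    refine key [] (by simp) trivial ?_
    refine ⟨q, p, by simpa only [List.append_nil] using hq,
      by simpa only [List.append_nil] using hp, ?_, ?_⟩
    · rw [hpq]
      exact mul_ne_zero hx0 hq0
    · rw [hpq, inv_mul_cancel_left₀ hx0]

/-- **Strassen's simulation along a computation sequence.** Numerator/denominator pairs for `A`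
inside an accumulated fan-in-two program `L` extend, along a computation sequence `lK` with
division over `A`, to pairs for `A ∪ lK` inside `L ++ L'` with `|L'| ≤ 4 |lK|`.
[cite: Strassen1973, §1] -/
theorem pairs_seq {σ : Type*} {K : Type*} [Field K]
    [Algebra (MvPolynomial σ ℂ) K] [Algebra ℂ K] [IsScalarTower ℂ (MvPolynomial σ ℂ) K]
    (lK : List K) :
    ∀ (A : Set K) (L : List (MvPolynomial σ ℂ)), DivSeq ℂ A lK → FanInTwoSeq (freeInputs ℂ σ) L →
      (∀ w ∈ A, ∃ p q : MvPolynomial σ ℂ, p ∈ freeInputs ℂ σ ∪ {x | x ∈ L} ∧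
        q ∈ freeInputs ℂ σ ∪ {x | x ∈ L} ∧ algebraMap (MvPolynomial σ ℂ) K q ≠ 0 ∧
        algebraMap (MvPolynomial σ ℂ) K p = w * algebraMap (MvPolynomial σ ℂ) K q) →
      ∃ L' : List (MvPolynomial σ ℂ), L'.length ≤ 4 * lK.length ∧
        FanInTwoSeq (freeInputs ℂ σ) (L ++ L') ∧
        ∀ w ∈ A ∪ {w | w ∈ lK}, ∃ p q : MvPolynomial σ ℂ,
          p ∈ freeInputs ℂ σ ∪ {x | x ∈ L ++ L'} ∧ q ∈ freeInputs ℂ σ ∪ {x | x ∈ L ++ L'} ∧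
          algebraMap (MvPolynomial σ ℂ) K q ≠ 0 ∧
          algebraMap (MvPolynomial σ ℂ) K p = w * algebraMap (MvPolynomial σ ℂ) K q := by
  induction lK with
  | nil =>
    intro A L _ hL hA
    refine ⟨[], by simp, by simpa only [List.append_nil] using hL, ?_⟩
    intro w hw
    rcases hw with hw | hw
    · obtain ⟨p, q, hp, hq, hq0, hpq⟩ := hA w hw
      exact ⟨p, q, by simpa only [List.append_nil] using hp,
        by simpa only [List.append_nil] using hq, hq0, hpq⟩
    · simp at hw
  | cons v lK ih =>
    intro A L hseq hL hA
    obtain ⟨L₁, hlen₁, hL₁, hA₁⟩ := pairs_step hL hA hseq.1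
    obtain ⟨L₂, hlen₂, hL₂, hA₂⟩ := ih (insert v A) (L ++ L₁) hseq.2 hL₁ hA₁
    refine ⟨L₁ ++ L₂, ?_, by simpa only [List.append_assoc] using hL₂, ?_⟩
    · simp only [List.length_append, List.length_cons]
      omega
    · intro w hw
      have hw' : w ∈ insert v A ∪ {w | w ∈ lK} := by
        rcases hw with hw | hw
        · exact Or.inl (Set.mem_insert_of_mem _ hw)
        · simp only [Set.mem_setOf_eq, List.mem_cons] at hw
          rcases hw with rfl | hw
          · exact Or.inl (Set.mem_insert _ _)
          · exact Or.inr hw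
      obtain ⟨p, q, hp, hq, hq0, hpq⟩ := hA₂ w hw'
      exact ⟨p, q, by simpa only [List.append_assoc] using hp,
        by simpa only [List.append_assoc] using hq, hq0, hpq⟩

/-! ## The registered stub -/

/-- **Stub `pairs`** — see the skeleton `Lines/Sketch.lean` for the informal statement. [cite: Strassen1973] -/
theorem stub_pairs {σ : Type} [DecidableEq σ] {K : Type} [Field K]
    [Algebra (MvPolynomial σ ℂ) K] [IsFractionRing (MvPolynomial σ ℂ) K] [Algebra ℂ K]
    [IsScalarTower ℂ (MvPolynomial σ ℂ) K]
    (l : List (MvPolynomial σ ℂ)) (hl : FanInTwoSeq (freeInputs ℂ σ) l) (n : ℕ) (B : Set K)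
    (hB : Derivable ℂ n ((algebraMap (MvPolynomial σ ℂ) K) '' (freeInputs ℂ σ ∪ {x | x ∈ l})) B)
    (f : MvPolynomial σ ℂ) (hf : algebraMap (MvPolynomial σ ℂ) K f ∈ B) :
    ∃ q : MvPolynomial σ ℂ, q ≠ 0 ∧ complexity (q * f) ≤ l.length + 4 * n := by
  obtain ⟨lK, hseq, hlen, hsub⟩ := hB
  -- base: the inputs are represented by the pairs `(g, 1)`
  have hA : ∀ w ∈ (algebraMap (MvPolynomial σ ℂ) K) '' (freeInputs ℂ σ ∪ {x | x ∈ l}),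
      ∃ p q : MvPolynomial σ ℂ, p ∈ freeInputs ℂ σ ∪ {x | x ∈ l} ∧
        q ∈ freeInputs ℂ σ ∪ {x | x ∈ l} ∧ algebraMap (MvPolynomial σ ℂ) K q ≠ 0 ∧
        algebraMap (MvPolynomial σ ℂ) K p = w * algebraMap (MvPolynomial σ ℂ) K q := by
    rintro _ ⟨g, hg, rfl⟩
    refine ⟨g, MvPolynomial.C 1, hg, Or.inl (ArithCircuit.C_mem_freeInputs 1), ?_, ?_⟩
    · rw [MvPolynomial.C_1, map_one]
      exact one_ne_zero
    · rw [MvPolynomial.C_1, map_one, mul_one]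
  obtain ⟨L', hlen', hL', hA'⟩ := pairs_seq lK _ l hseq hl hA
  have hfmem : algebraMap (MvPolynomial σ ℂ) K f ∈
      ((algebraMap (MvPolynomial σ ℂ) K) '' (freeInputs ℂ σ ∪ {x | x ∈ l}) ∪ {w | w ∈ lK}) ∪
        Set.range (algebraMap ℂ K) := by
    rcases hsub hf with (h | h) | h
    · exact Or.inl (Or.inl h)
    · exact Or.inr h
    · exact Or.inl (Or.inr h)
  obtain ⟨p, q, hp, -, hq0, hpq⟩ := pairs_of_mem_union_consts hA' hfmem
  have hq : q ≠ 0 := by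
    rintro rfl
    exact hq0 (map_zero _)
  have hpf : p = q * f := by
    apply IsFractionRing.injective (MvPolynomial σ ℂ) K
    rw [hpq, map_mul, mul_comm]
  refine ⟨q, hq, ?_⟩
  rw [← hpf]
  calc complexity p ≤ (l ++ L').length := complexity_le_length_of_fanInTwoSeq hL' hp
    _ ≤ l.length + 4 * n := by
      simp only [List.length_append]
      omega

end

end Summit.MatrixMultiplication.MatrixMultiplication.Theorems
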